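import Literature.NumberTheory.DiophantineGeometry.GenEllKummerFieldDifferent
import Literature.NumberTheory.DiophantineGeometry.GenEllConductorDifferent
import Literature.NumberTheory.EllipticCurves.HeightsBaseChangeProofs
import Mathlib.FieldTheory.SplittingField.Construction
import Mathlib.RingTheory.AdjoinRoot

/-!
# [GenEll] Thm 2.1 for `ℙ¹` (route piece W5-F-b): the `D_e`-point over a point of `ℙ¹`, as an `NFPoint`

Support construction for the cell's number-field-only architecture of `GenEllTwo` (stmt-ABC-19679;
S. Mochizuki, *Arithmetic elliptic curves in general position*, Math. J. Okayama Univ. **52**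
(2010), Thm. 2.1 (ii) ⇒ (i), proof p. 12: every point of `U_X(ℚ̄)^{≤d}` «lifts» to a point of the
ramified cover `Y → X` over a field of degree `≤ d·deg(Y/X)`; package map `GENELLTWO-P1ROUTE.md` of
seat abc-iut-S6, §2 (A) «for a point `x ∈ U(ℚ̄)`, `K := ℚ(x)`, the points of `D_e` over `x` are
`P = (x, r)`, `r^e = x(1−x)`, field `L := ℚ(x, r)`, `[L:ℚ] ≤ e·[K:ℚ]`», and S6's W9 assembly
(STATUS 2026-08-26T00:32:17Z: «`Q P := the D_e-point over γ(P)` — W5-F/W4a give its `NFPoint`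
presentation `ℚ(γx, r)`»).

For a presented point `P = (F, x)` (`GenEllProjLine.NFPoint`) and `e ≥ 1` we CONSTRUCT:
* `P.deField e := F[Y]/(q)` for an irreducible factor `q` of `Y^e − x(1−x)` (Mathlib `AdjoinRoot`,
  `Polynomial.factor`) — a number field, generated over `F` by the class `r` of `Y`;
* `P.deRoot e = r` with `r^e = x(1−x)` (`deRoot_pow`) and `F(r) = F[Y]/(q)`
  (`adjoin_deRoot : IntermediateField.adjoin F {r} = ⊤`);
* `P.dePoint e : NFPoint := (F(r), x)` — the SAME point of `ℙ¹`, presented over `F(r) = ℚ(x, r)`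
  when `F = ℚ(x)`; `degree_dePoint_le : [F(r):ℚ] ≤ e·[F:ℚ]`;
* `logDiff_dePoint_le`: `(P.dePoint e).logDiff ≤ P.logDiff + P.logCond + 2·log(e·(e·e!))` — the
  hypothesis `hQ` of S6's `vojtaIneq_of_belyi_mechanism` VERBATIM, by S6's landed
  `NFPoint.logDiff_le_of_kummer_generator` (p412501, [GenEll] Prop 1.7 (i) for the Kummer cover).

The `Field`/`NumberField`/`Algebra F` structures on `P.deField e` are Mathlib's `AdjoinRoot`
instances (the irreducibility `Fact` and the `NumberField` instance are registered here for this
NEW type only; nothing existing is overridden).  Classical; nothing here bears on [IUTchIII].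
-/

noncomputable section

open Polynomial NumberField

namespace Literature.NumberTheory.DiophantineGeometry.GenEll

namespace NFPoint

variable (P : NFPoint) (e : ℕ)

/-- The Kummer polynomial `Y^e − x(1−x) ∈ F[Y]` of the cover `D_e → ℙ¹` at the point `x`.
[cite: MochizukiGenEll2010, Thm 2.1 proof p.12 (the cover Y → X), P1ROUTE §2 (A)] -/
def dePoly : P.F[X] := X ^ e - C (P.x * (1 - P.x))

/-- `dePoly` is monic of degree `e`. [cite: MochizukiGenEll2010, Thm 2.1 proof p.12, P1ROUTE §2 (A)] -/
theorem natDegree_dePoly : (P.dePoly e).natDegree = e := by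
  rw [dePoly, natDegree_X_pow_sub_C]

/-- An irreducible factor `q` of `Y^e − x(1−x)` over `F` (Mathlib `Polynomial.factor`); the field
`F(r)` of a point of `D_e` over `x` is `F[Y]/(q)`. [cite: MochizukiGenEll2010, Thm 2.1 proof p.12, P1ROUTE §2 (A)] -/
def deFactor : P.F[X] := (P.dePoly e).factor

/-- `q` is irreducible. [cite: MochizukiGenEll2010, Thm 2.1 proof p.12, P1ROUTE §2 (A)] -/
theorem irreducible_deFactor : Irreducible (P.deFactor e) := irreducible_factor _

/-- The irreducibility of `q` as a `Fact` instance (needed for the field structure on `F[Y]/(q)`;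
registered for this new polynomial only). [cite: MochizukiGenEll2010, Thm 2.1 proof p.12, P1ROUTE §2 (A)] -/
instance fact_irreducible_deFactor : Fact (Irreducible (P.deFactor e)) := ⟨irreducible_deFactor P e⟩

/-- `q ∣ Y^e − x(1−x)` (for `e ≥ 1`). [cite: MochizukiGenEll2010, Thm 2.1 proof p.12, P1ROUTE §2 (A)] -/
theorem deFactor_dvd (he : 0 < e) : P.deFactor e ∣ P.dePoly e :=
  factor_dvd_of_natDegree_ne_zero (by rw [natDegree_dePoly]; omega)

/-- **The field `F(r) = F[Y]/(q)`** over which the `D_e`-point over `P` is presented (Mathlib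
`AdjoinRoot`; a field since `q` is irreducible). [cite: MochizukiGenEll2010, Thm 2.1 proof p.12 («Y(ℚ̄)^{≤d′}»), P1ROUTE §2 (A)] -/
abbrev deField : Type := AdjoinRoot (P.deFactor e)

/-- `F(r)` is finite over `F` (power basis `1, r, …, r^{deg q − 1}`).
[cite: MochizukiGenEll2010, Thm 2.1 proof p.12, P1ROUTE §2 (A)] -/
instance deField_moduleFinite : Module.Finite P.F (P.deField e) :=
  (AdjoinRoot.powerBasis (irreducible_deFactor P e).ne_zero).finite

/-- `F(r)` is a number field (finite over the number field `F`).
[cite: MochizukiGenEll2010, Thm 2.1 proof p.12, P1ROUTE §2 (A)] -/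
instance deField_numberField : NumberField (P.deField e) := NumberField.of_module_finite P.F _

/-- **The root `r ∈ F(r)`** (the class of `Y`). [cite: MochizukiGenEll2010, Thm 2.1 proof p.12, P1ROUTE §2 (A)] -/
def deRoot : P.deField e := AdjoinRoot.root (P.deFactor e)

/-- **`r^e = x(1−x)`** in `F(r)` (for `e ≥ 1`): `r` is a root of `q`, hence of `Y^e − x(1−x)`.
[cite: MochizukiGenEll2010, Thm 2.1 proof p.12, P1ROUTE §2 (A)] -/
theorem deRoot_pow (he : 0 < e) :
    P.deRoot e ^ e = algebraMap P.F (P.deField e) (P.x * (1 - P.x)) := by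
  have h : aeval (P.deRoot e) (P.dePoly e) = 0 := by
    rw [deRoot, AdjoinRoot.aeval_eq, AdjoinRoot.mk_eq_zero]
    exact P.deFactor_dvd e he
  rw [dePoly, map_sub, map_pow, aeval_X, aeval_C, sub_eq_zero] at h
  exact h

/-- **`F(r)` is generated by `r` over `F`**: `IntermediateField.adjoin F {r} = ⊤` (the hypothesis
`hgen` of `NFPoint.logDiff_le_of_kummer_generator`). [cite: MochizukiGenEll2010, Thm 2.1 proof p.12, P1ROUTE §2 (A)] -/
theorem adjoin_deRoot : IntermediateField.adjoin P.F ({P.deRoot e} : Set (P.deField e)) = ⊤ := by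
  have halg : IsAlgebraic P.F (P.deRoot e) := Algebra.IsAlgebraic.isAlgebraic _
  apply IntermediateField.toSubalgebra_injective
  rw [IntermediateField.adjoin_simple_toSubalgebra_of_isAlgebraic halg,
    IntermediateField.top_toSubalgebra]
  exact AdjoinRoot.adjoinRoot_eq_top

/-- `[F(r) : F] ≤ e`. [cite: MochizukiGenEll2010, Thm 2.1 proof p.12 (d′ = d·deg), P1ROUTE §2 (A) ([L:ℚ] ≤ e[K:ℚ])] -/
theorem finrank_deField_le (he : 0 < e) : Module.finrank P.F (P.deField e) ≤ e := by
  rw [(AdjoinRoot.powerBasis (irreducible_deFactor P e).ne_zero).finrank, AdjoinRoot.powerBasis_dim]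
  have h0 : P.dePoly e ≠ 0 := by
    rw [dePoly]; exact (monic_X_pow_sub_C _ (by omega)).ne_zero
  calc (P.deFactor e).natDegree ≤ (P.dePoly e).natDegree := natDegree_le_of_dvd (P.deFactor_dvd e he) h0
    _ = e := natDegree_dePoly P e

/-- **The `D_e`-point over `P`, as an `NFPoint`**: the same point `x` of `ℙ¹`, presented over the
field `F(r)`, `r^e = x(1−x)` — «`Q P`» of S6's W9 assembly; GENELLTWO-P1ROUTE §2 (A) «the points of
`D_e` over `x` are `P = (x, r)` … field `L := ℚ(x, r)`».  (An `abbrev`, so that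
`(P.dePoint e).F` is `P.deField e` by `rfl` and Mathlib's `Algebra P.F (AdjoinRoot _)` instance is
found on it.) [cite: MochizukiGenEll2010, Thm 2.1 proof p.12 («every point of U_X(ℚ̄)^{≤d} lifts to U_Y(ℚ̄)^{≤d′}»), P1ROUTE §2 (A)] -/
abbrev dePoint : NFPoint := ⟨P.deField e, algebraMap P.F (P.deField e) P.x⟩

/-- The presenting field of `P.dePoint e` is `F(r)`. [cite: MochizukiGenEll2010, Thm 2.1 proof p.12, P1ROUTE §2 (A)] -/
theorem dePoint_F : (P.dePoint e).F = P.deField e := rfl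

/-- The coordinate of `P.dePoint e` is `x` (viewed in `F(r)`). [cite: MochizukiGenEll2010, Thm 2.1 proof p.12, P1ROUTE §2 (A)] -/
theorem dePoint_x : (P.dePoint e).x = algebraMap P.F (P.deField e) P.x := rfl

/-- `P.dePoint e` lies in `U = ℙ¹ ∖ {0,1,∞}` iff `P` does. [cite: MochizukiGenEll2010, Thm 2.1 (ii) p.11 (U_P), P1ROUTE §2 (A)] -/
theorem inU_dePoint_iff : (P.dePoint e).InU ↔ P.InU := by
  simp only [InU, ne_eq, map_eq_zero_iff _ (algebraMap P.F (P.deField e)).injective]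
  rw [← (algebraMap P.F (P.deField e)).map_one, (algebraMap P.F (P.deField e)).injective.eq_iff]

/-- **Degree bound**: `[F(r) : ℚ] ≤ e · [F : ℚ]` (the «`d′ = d·deg(Y/X)`» of [GenEll] p. 12;
P1ROUTE §2 (A): `[L:ℚ] ≤ e·[K:ℚ]`). [cite: MochizukiGenEll2010, Thm 2.1 proof p.12, P1ROUTE §2 (A)] -/
theorem degree_dePoint_le (he : 0 < e) : (P.dePoint e).degree ≤ e * P.degree := by
  unfold degree
  change Module.finrank ℚ (P.deField e) ≤ e * Module.finrank ℚ P.F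
  rw [← Module.finrank_mul_finrank ℚ P.F (P.deField e), mul_comm]
  exact Nat.mul_le_mul_right _ (P.finrank_deField_le e he)

/-- `P.dePoint e` has degree ≤ d′ whenever `P` has degree ≤ d and `e·d ≤ d′` (membership in
`UPle` needs minimality in addition, which W9 obtains by re-presentation `imageAt`).
[cite: MochizukiGenEll2010, Thm 2.1 proof p.12, P1ROUTE §2 (A)] -/
theorem degree_dePoint_le_of_le (he : 0 < e) {d d' : ℕ} (hd : P.degree ≤ d) (hd' : e * d ≤ d') :
    (P.dePoint e).degree ≤ d' :=
  (P.degree_dePoint_le e he).trans ((Nat.mul_le_mul_left e hd).trans hd')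

/-- **The normalised height is unchanged**: `ht(F(r), x) = ht(F, x)` (independence of the absolute
height of the presenting field, Bombieri–Gubler Lemma 1.5.2 via the tree's
`NumberField.logHeight₁_map_ringHom`). [cite: MochizukiGenEll2010, Def 1.2 (i) p.5 (heights), P1ROUTE §3 (b)] -/
theorem ht_dePoint : (P.dePoint e).ht = P.ht := by
  have h := NumberField.logHeight₁_map_ringHom (algebraMap P.F (P.deField e)) P.x
  have hQ : (0 : ℝ) < (P.dePoint e).degree := Nat.cast_pos.mpr (P.dePoint e).degree_pos
  have hP : (0 : ℝ) < P.degree := Nat.cast_pos.mpr P.degree_pos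
  unfold ht
  change ((P.dePoint e).degree : ℝ)⁻¹ * Height.logHeight₁ (algebraMap P.F (P.deField e) P.x) =
    (P.degree : ℝ)⁻¹ * Height.logHeight₁ P.x
  change (P.degree : ℝ) * Height.logHeight₁ (algebraMap P.F (P.deField e) P.x) =
    ((P.dePoint e).degree : ℝ) * Height.logHeight₁ P.x at h
  field_simp
  linarith

/-- `log-diff` does not decrease from `P` to `P.dePoint e` (`F ⊆ F(r)`).
[cite: MochizukiGenEll2010, Prop 1.7 (i) p.10 (left inequality, constant 0), P1ROUTE §3 (c)] -/
theorem logDiff_le_logDiff_dePoint : P.logDiff ≤ (P.dePoint e).logDiff :=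
  logDiff_le_logDiff_of_ringHom P (P.dePoint e) (algebraMap P.F (P.deField e))

/-- **The log-different bound for the `D_e`-point** (hypothesis `hQ` of S6's
`vojtaIneq_of_belyi_mechanism`, VERBATIM): for `P ∈ U`,
`(P.dePoint e).logDiff ≤ P.logDiff + P.logCond + 2·log(e·(e·e!))` — S6's landed
`NFPoint.logDiff_le_of_kummer_generator` ([GenEll] Prop. 1.7 (i) for the Kummer cover, p412501)
applied with `r := P.deRoot e`. [cite: MochizukiGenEll2010, Prop 1.7 (i) p.10, P1ROUTE §2 (A) (1.7R)] -/
theorem logDiff_dePoint_le (hP : P.InU) (he : 0 < e) :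
    (P.dePoint e).logDiff ≤ P.logDiff + P.logCond + 2 * Real.log ((e * (e * e.factorial) : ℕ) : ℝ) :=
  NFPoint.logDiff_le_of_kummer_generator P (P.dePoint e) hP he (P.deRoot_pow e he)
    (P.adjoin_deRoot e)

end NFPoint

end Literature.NumberTheory.DiophantineGeometry.GenEll

end
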